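import Summits.NavierStokesRegularity.NavierStokesRegularity.Theses.QuantisedSymmetry
import Summits.NavierStokesRegularity.NavierStokesRegularity.Theorems.FilamentSkeletonRssRdssProfileTruncation
import Literature.Analysis.FluidPDE.SelfSimilar
import HarnessLib

/-!
# Route `QuantisedSymmetry`, crux `PolyhedralTruncationBridge` (stmt-NavierStokesRegularity-11331)

`PolyhedralTruncationBridge`: for every finite irreducible proper rotation group `G`, every `λ > 1`
and every nontrivial `G`-equivariant `λ`-discretely-self-similar ancient mild solution `u` (`ν = 1`,
measurable slices) with the Type-I bound `‖u(t,x)‖ ≤ C₀/(‖x‖ + √(−t))`, some rapidly decaying datum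
has a Leray–Hopf classical solution of finite maximal lifespan
(`∃ ν > 0, ∃ T > 0, ∃ v p, IsMaximalSmoothSolution ν 0 v p T ∧ IsLerayHopfOn T ν 0 (v 0) v ∧
HasRapidSpatialDecay (v 0)`).

Proof. The conclusion does not mention `G`, `c` or `u`, and the hypotheses on `u` are an instance of
the antecedent of the conjecture-free ROTATED truncation bridge
`Theses.FilamentSkeletonRss.RdssProfileTruncation` (stmt-NavierStokesRegularity-11289), proved in the
tree as `Theorems.filamentSkeletonRss_rdssProfileTruncation_proof` (line `Sketch`, subcritical
quasi-compact steering): a `λ`-DSS field is rotated-DSS with the trivial rotation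
(`Literature.Analysis.FluidPDE.isRotatedDSS_refl_iff`, Chae–Wolf 2017, remark after Def. 1.1). The
group-theoretic clauses (finiteness, `det = 1`, irreducibility, equivariance) select the sector and
are not needed for the transfer.
-/

-- the summit namespace `…NavierStokesRegularity.NavierStokesRegularity…` is the tree convention (D-0017)
set_option linter.dupNamespace false

namespace Summit.NavierStokesRegularity.NavierStokesRegularity.Theorems

open MeasureTheory Set Filter
open Literature.Analysis.FluidPDE

/-- **`PolyhedralTruncationBridge`** (route `QuantisedSymmetry`, crux stmt-NavierStokesRegularity-11331):
a nontrivial `G`-equivariant Type-I `λ`-DSS ancient mild profile (`G` finite, irreducible, proper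
rotations; `λ > 1`) yields a rapidly decaying datum whose Leray–Hopf classical solution has finite
maximal lifespan. Instance of the rotated truncation bridge
`filamentSkeletonRss_rdssProfileTruncation_proof` at `R = LinearIsometryEquiv.refl`
(`isRotatedDSS_refl_iff`: plain `λ`-DSS is rotated `λ`-DSS with the trivial rotation,
Chae–Wolf 2017, remark after Def. 1.1). [folklore] -/
theorem quantisedSymmetry_polyhedralTruncationBridge_proof :
    Summit.NavierStokesRegularity.NavierStokesRegularity.Theses.QuantisedSymmetry.PolyhedralTruncationBridge := by
  unfold Summit.NavierStokesRegularity.NavierStokesRegularity.Theses.QuantisedSymmetry.PolyhedralTruncationBridge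
  intro _G _hfin _hdet _hirr c hc u hanc hmeas hdss hdec _heqv hnt
  exact filamentSkeletonRss_rdssProfileTruncation_proof
    ⟨c, LinearIsometryEquiv.refl ℝ (EuclideanSpace ℝ (Fin 3)), u, hc, hanc, hmeas,
      isRotatedDSS_refl_iff.mpr hdss, hdec, hnt⟩

end Summit.NavierStokesRegularity.NavierStokesRegularity.Theorems
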